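import Summits.QuantumFields.YangMills.Theses.AntiScreeningCeilings

/-!
# Route `AntiScreeningCeilings` — LINE C support item `AbelWindowTransfer` (stmt-QuantumFields-27439): PROVED

D-0145 ideator seat ym-idea-11 (generation g4, lens «wuc»).  Pure real analysis behind the spectral split of the crux
`ScaleMonotonicity`: for a finite positive measure `ν` on `(0,∞)` whose cumulative weight obeys the degree-8 doubling bound
`ν([0,λx)) ≤ A λ⁸ ν([0,x))` (`λ ≥ 1`, `x ≥ E₀`), the symmetrised Laplace transform `F(t) = κ₀ + ∫ (e^{-Et} + e^{-E(T-t)}) dν`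
satisfies `t⁸ F(t) ≤ A (1+e⁴) t₂⁸ F(t₂)` for `1 ≤ t ≤ t₂`, `2t₂ ≤ T`, `t₂ E₀ ≤ 4`.

Proof: layer cake `∫ e^{-Eτ} dν = ∫₀^∞ ν([0,-log s/τ)) ds` (`lintegral_eq_lintegral_meas_lt`); with `λ = t₂/t` the integrand at `t`
is `ν([0, λ·y(s)))`, `y(s) = -log s/t₂`; doubling for `y ≥ E₀`, monotonicity + doubling at `E₀` for `0 < y < E₀` (i.e. `e^{-t₂E₀} < s < 1`),
nothing for `s ≥ 1`; and `ν([0,E₀))·e^{-t₂E₀} ≤ ∫ e^{-Et₂} dν`.  The `κ₀` and increasing (`e^{-E(T-t)}`) parts are monotone in `t`.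
Mathlib only below the route import; closes ONLY the support item; no crux, leaf, NT, UV or IR statement is proved.
-/

namespace Summit.QuantumFields.YangMills.Cruxes.ScaleMonotonicity.Spectral

open MeasureTheory Set

/-- the super-level sets of `E ↦ e^{-Eτ}` are left half-lines. -/
theorem superlevel_eq (s τ : ℝ) (hs : 0 < s) (hτ : 0 < τ) :
    {E : ℝ | s < Real.exp (-(E * τ))} = Iio (-Real.log s / τ) := by
  ext E
  simp only [mem_setOf_eq, mem_Iio]
  rw [← Real.log_lt_iff_lt_exp hs, lt_div_iff₀ hτ]
  constructor <;> intro h <;> linarith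

/-- layer cake for the Laplace transform of a finite measure: `∫ e^{-Eτ} dν = ∫₀^∞ ν([·<-log s/τ]) ds`. -/
theorem laplace_layer_cake (ν : Measure ℝ) [IsFiniteMeasure ν] (τ : ℝ) (hτ : 0 < τ) :
    ∫⁻ E, ENNReal.ofReal (Real.exp (-(E * τ))) ∂ν = ∫⁻ s in Ioi 0, ν (Iio (-Real.log s / τ)) := by
  have hmeas : AEMeasurable (fun E : ℝ => Real.exp (-(E * τ))) ν :=
    (Measurable.aemeasurable (by fun_prop))
  rw [lintegral_eq_lintegral_meas_lt ν (Filter.Eventually.of_forall fun E => (Real.exp_pos _).le) hmeas]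
  refine setLIntegral_congr_fun measurableSet_Ioi (fun s hs => ?_)
  rw [superlevel_eq s τ hs hτ]

/-- the cumulative weight vanishes at non-positive energies when `ν` lives on `(0,∞)`. -/
theorem cum_zero (ν : Measure ℝ) (hsupp : ν (Iic 0) = 0) (x : ℝ) (hx : x ≤ 0) : ν (Iio x) = 0 :=
  measure_mono_null (fun _ he => le_trans (le_of_lt he) hx) hsupp

/-- DILATION BOUND: doubling above `E₀` and `t₂ E₀ ≤ 4` give `∫ e^{-Et} dν ≤ A (t₂/t)⁸ (1+e⁴) ∫ e^{-Et₂} dν`. -/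
theorem laplace_dilation_bound (ν : Measure ℝ) [IsFiniteMeasure ν] (hsupp : ν (Iic 0) = 0) (A E₀ : ℝ)
    (hA : 1 ≤ A) (_hE₀ : 0 < E₀)
    (hdbl : ∀ lam x : ℝ, 1 ≤ lam → E₀ ≤ x → ν (Iio (lam * x)) ≤ ENNReal.ofReal (A * lam ^ 8) * ν (Iio x))
    {t t₂ : ℝ} (ht : 0 < t) (htt : t ≤ t₂) (hwin : t₂ * E₀ ≤ 4) :
    ∫⁻ E, ENNReal.ofReal (Real.exp (-(E * t))) ∂ν ≤
      ENNReal.ofReal (A * (t₂ / t) ^ 8 * (1 + Real.exp 4)) * ∫⁻ E, ENNReal.ofReal (Real.exp (-(E * t₂))) ∂ν := by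
  have ht₂ : 0 < t₂ := lt_of_lt_of_le ht htt
  set lam := t₂ / t with hlam
  have hlam1 : 1 ≤ lam := by rw [hlam, le_div_iff₀ ht]; linarith
  have hlam0 : 0 ≤ lam := le_trans zero_le_one hlam1
  have hAl : 0 ≤ A * lam ^ 8 := by positivity
  set N : ℝ → ENNReal := fun x => ν (Iio x) with hN
  have hNmono : Monotone N := fun a b hab => measure_mono (Iio_subset_Iio hab)
  have hNtop : ∀ x, N x ≠ ⊤ := fun x => measure_ne_top ν _
  rw [laplace_layer_cake ν t ht, laplace_layer_cake ν t₂ ht₂]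
  have hy : ∀ s : ℝ, -Real.log s / t = lam * (-Real.log s / t₂) := by
    intro s; rw [hlam]; field_simp
  set s₀ := Real.exp (-(t₂ * E₀)) with hs₀
  have hs₀pos : 0 < s₀ := Real.exp_pos _
  -- pointwise bound on (0,∞)
  have hpt : ∀ s ∈ Ioi (0:ℝ),
      N (-Real.log s / t) ≤ ENNReal.ofReal (A * lam ^ 8) * N (-Real.log s / t₂) + ENNReal.ofReal (A * lam ^ 8) * N E₀ * (Ioo (0:ℝ) 1).indicator 1 s := by
    intro s hs
    have hs' : (0:ℝ) < s := hs
    rw [hy s]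
    by_cases h1 : E₀ ≤ -Real.log s / t₂
    · calc N (lam * (-Real.log s / t₂)) ≤ ENNReal.ofReal (A * lam ^ 8) * N (-Real.log s / t₂) := hdbl lam _ hlam1 h1
        _ ≤ _ := le_self_add
    · push Not at h1
      by_cases h2 : s < 1
      · have hind : (Ioo (0:ℝ) 1).indicator (1 : ℝ → ENNReal) s = 1 := by
          simp [indicator, hs', h2]
        calc N (lam * (-Real.log s / t₂)) ≤ N (lam * E₀) :=
              hNmono (mul_le_mul_of_nonneg_left h1.le hlam0)
          _ ≤ ENNReal.ofReal (A * lam ^ 8) * N E₀ := hdbl lam E₀ hlam1 le_rfl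
          _ = ENNReal.ofReal (A * lam ^ 8) * N E₀ * (Ioo (0:ℝ) 1).indicator 1 s := by rw [hind, mul_one]
          _ ≤ _ := le_add_self
      · push Not at h2
        have hlog : 0 ≤ Real.log s := Real.log_nonneg h2
        have hy0 : lam * (-Real.log s / t₂) ≤ 0 := by
          have : -Real.log s / t₂ ≤ 0 := div_nonpos_iff.mpr (Or.inr ⟨by linarith, ht₂.le⟩)
          nlinarith
        rw [show N (lam * (-Real.log s / t₂)) = 0 from cum_zero ν hsupp _ hy0]
        exact bot_le
  -- the indicator integrates to 1 on (0,∞)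
  have hmeasInd : Measurable fun s : ℝ => ENNReal.ofReal (A * lam ^ 8) * N E₀ * (Ioo (0:ℝ) 1).indicator (1 : ℝ → ENNReal) s :=
    (measurable_const.indicator measurableSet_Ioo).const_mul _
  have hInd : ∫⁻ s in Ioi (0:ℝ), ENNReal.ofReal (A * lam ^ 8) * N E₀ * (Ioo (0:ℝ) 1).indicator (1 : ℝ → ENNReal) s = ENNReal.ofReal (A * lam ^ 8) * N E₀ := by
    rw [lintegral_const_mul' _ _ (ENNReal.mul_ne_top ENNReal.ofReal_ne_top (hNtop E₀)),
      lintegral_indicator_one measurableSet_Ioo, Measure.restrict_apply measurableSet_Ioo,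
      show Ioo (0:ℝ) 1 ∩ Ioi 0 = Ioo 0 1 from inter_eq_left.mpr Ioo_subset_Ioi_self, Real.volume_Ioo]
    simp
  -- lower bound: ν([0,E₀)) · s₀ ≤ ∫ e^{-E t₂}
  have hlow : N E₀ * ENNReal.ofReal s₀ ≤ ∫⁻ s in Ioi (0:ℝ), N (-Real.log s / t₂) := by
    have h1 : ∫⁻ s in Ioo (0:ℝ) s₀, N E₀ ≤ ∫⁻ s in Ioo (0:ℝ) s₀, N (-Real.log s / t₂) := by
      refine setLIntegral_mono' measurableSet_Ioo (fun s hs => hNmono ?_)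
      obtain ⟨hs0, hs1⟩ := hs
      rw [le_div_iff₀ ht₂]
      have : Real.log s < -(t₂ * E₀) := by
        rw [Real.log_lt_iff_lt_exp hs0]; exact hs1
      linarith
    have h2 : ∫⁻ s in Ioo (0:ℝ) s₀, N (-Real.log s / t₂) ≤ ∫⁻ s in Ioi (0:ℝ), N (-Real.log s / t₂) :=
      lintegral_mono_set Ioo_subset_Ioi_self
    rw [setLIntegral_const, Real.volume_Ioo, sub_zero] at h1
    exact h1.trans h2
  have hes : 1 ≤ ENNReal.ofReal (Real.exp 4) * ENNReal.ofReal s₀ := by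
    rw [← ENNReal.ofReal_mul (Real.exp_pos 4).le, ← ENNReal.ofReal_one]
    apply ENNReal.ofReal_le_ofReal
    rw [hs₀, ← Real.exp_add]
    apply Real.one_le_exp_iff.mpr; linarith
  -- integrate the pointwise bound
  have step1 : ∫⁻ s in Ioi (0:ℝ), N (-Real.log s / t) ≤
      ENNReal.ofReal (A * lam ^ 8) * (∫⁻ s in Ioi (0:ℝ), N (-Real.log s / t₂)) + ENNReal.ofReal (A * lam ^ 8) * N E₀ := by
    calc ∫⁻ s in Ioi (0:ℝ), N (-Real.log s / t)
        ≤ ∫⁻ s in Ioi (0:ℝ), (ENNReal.ofReal (A * lam ^ 8) * N (-Real.log s / t₂)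
            + ENNReal.ofReal (A * lam ^ 8) * N E₀ * (Ioo (0:ℝ) 1).indicator 1 s) :=
          setLIntegral_mono' measurableSet_Ioi hpt
      _ = ENNReal.ofReal (A * lam ^ 8) * (∫⁻ s in Ioi (0:ℝ), N (-Real.log s / t₂))
            + ENNReal.ofReal (A * lam ^ 8) * N E₀ := by
          rw [lintegral_add_right _ hmeasInd, hInd, lintegral_const_mul' _ _ ENNReal.ofReal_ne_top]
  have step2 : N E₀ ≤ ENNReal.ofReal (Real.exp 4) * ∫⁻ s in Ioi (0:ℝ), N (-Real.log s / t₂) :=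
    calc N E₀ = 1 * N E₀ := (one_mul _).symm
      _ ≤ (ENNReal.ofReal (Real.exp 4) * ENNReal.ofReal s₀) * N E₀ := mul_le_mul_left hes _
      _ = ENNReal.ofReal (Real.exp 4) * (N E₀ * ENNReal.ofReal s₀) := by ring
      _ ≤ ENNReal.ofReal (Real.exp 4) * ∫⁻ s in Ioi (0:ℝ), N (-Real.log s / t₂) := mul_le_mul_right hlow _
  have alg : ∀ a e I : ENNReal, a * I + a * (e * I) = (a + a * e) * I := fun a e I => by ring
  calc ∫⁻ s in Ioi (0:ℝ), N (-Real.log s / t)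
      ≤ ENNReal.ofReal (A * lam ^ 8) * (∫⁻ s in Ioi (0:ℝ), N (-Real.log s / t₂))
          + ENNReal.ofReal (A * lam ^ 8) * N E₀ := step1
    _ ≤ ENNReal.ofReal (A * lam ^ 8) * (∫⁻ s in Ioi (0:ℝ), N (-Real.log s / t₂))
          + ENNReal.ofReal (A * lam ^ 8) * (ENNReal.ofReal (Real.exp 4) * ∫⁻ s in Ioi (0:ℝ), N (-Real.log s / t₂)) := by
        gcongr
    _ = ENNReal.ofReal (A * lam ^ 8 * (1 + Real.exp 4)) * ∫⁻ s in Ioi (0:ℝ), N (-Real.log s / t₂) := by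
        rw [alg, ← ENNReal.ofReal_mul hAl, ← ENNReal.ofReal_add hAl (by positivity),
          show A * lam ^ 8 + A * lam ^ 8 * Real.exp 4 = A * lam ^ 8 * (1 + Real.exp 4) by ring]

/-- doubling in `toReal` form (as in the route item) ⇒ doubling in `ℝ≥0∞` form. -/
theorem doubling_ennreal (ν : Measure ℝ) [IsFiniteMeasure ν] (A E₀ : ℝ) (hA : 1 ≤ A)
    (hdbl : ∀ lam x : ℝ, 1 ≤ lam → E₀ ≤ x → (ν (Iio (lam * x))).toReal ≤ A * lam ^ 8 * (ν (Iio x)).toReal) :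
    ∀ lam x : ℝ, 1 ≤ lam → E₀ ≤ x → ν (Iio (lam * x)) ≤ ENNReal.ofReal (A * lam ^ 8) * ν (Iio x) := by
  intro lam x hl hx
  have h := hdbl lam x hl hx
  have hl0 : 0 ≤ lam := le_trans zero_le_one hl
  have hAl : 0 ≤ A * lam ^ 8 := by positivity
  calc ν (Iio (lam * x)) = ENNReal.ofReal ((ν (Iio (lam * x))).toReal) :=
        (ENNReal.ofReal_toReal (measure_ne_top ν _)).symm
    _ ≤ ENNReal.ofReal (A * lam ^ 8 * (ν (Iio x)).toReal) := ENNReal.ofReal_le_ofReal h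
    _ = ENNReal.ofReal (A * lam ^ 8) * ν (Iio x) := by
        rw [ENNReal.ofReal_mul hAl, ENNReal.ofReal_toReal (measure_ne_top ν _)]

/-- a finite measure on `(0,∞)` integrates every `e^{-Eτ}`, `τ ≥ 0`. -/
theorem exp_integrable (ν : Measure ℝ) [IsFiniteMeasure ν] (hsupp : ν (Iic 0) = 0) (τ : ℝ) (hτ : 0 ≤ τ) :
    Integrable (fun E : ℝ => Real.exp (-(E * τ))) ν := by
  have hae : ∀ᵐ E ∂ν, 0 < E := by
    have h : ∀ᵐ E ∂ν, E ∉ Iic (0:ℝ) := compl_mem_ae_iff.mpr hsupp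
    filter_upwards [h] with E hE
    exact not_le.mp hE
  refine Integrable.mono' (integrable_const (1:ℝ)) ?_ ?_
  · exact (by fun_prop : Continuous fun E : ℝ => Real.exp (-(E * τ))).aestronglyMeasurable
  · filter_upwards [hae] with E hE
    rw [Real.norm_eq_abs, abs_of_pos (Real.exp_pos _)]
    apply Real.exp_le_one_iff.mpr
    nlinarith

/-- **AbelWindowTransfer (core form).**  The route's support item, with its hypotheses as arguments. -/
theorem abelWindowTransfer_core (ν : Measure ℝ) (κ₀ A E₀ T : ℝ) (hfin : IsFiniteMeasure ν)
    (hsupp : ν (Iic 0) = 0) (hκ₀ : 0 ≤ κ₀) (hA : 1 ≤ A) (hE₀ : 0 < E₀)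
    (hdbl : ∀ lam x : ℝ, 1 ≤ lam → E₀ ≤ x → (ν (Iio (lam * x))).toReal ≤ A * lam ^ 8 * (ν (Iio x)).toReal)
    (t t₂ : ℝ) (ht : 1 ≤ t) (htt : t ≤ t₂) (hT : 2 * t₂ ≤ T) (hwin : t₂ * E₀ ≤ 4) :
    t ^ 8 * (κ₀ + ∫ E, (Real.exp (-(E * t)) + Real.exp (-(E * (T - t)))) ∂ν) ≤
      A * (1 + Real.exp 4) * t₂ ^ 8 * (κ₀ + ∫ E, (Real.exp (-(E * t₂)) + Real.exp (-(E * (T - t₂)))) ∂ν) := by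
  have ht0 : 0 < t := by linarith
  have ht₂ : 0 < t₂ := by linarith
  have hae : ∀ᵐ E ∂ν, 0 < E := by
    have h : ∀ᵐ E ∂ν, E ∉ Iic (0:ℝ) := compl_mem_ae_iff.mpr hsupp
    filter_upwards [h] with E hE
    exact not_le.mp hE
  rw [integral_add (exp_integrable ν hsupp t ht0.le) (exp_integrable ν hsupp (T - t) (by linarith)),
    integral_add (exp_integrable ν hsupp t₂ ht₂.le) (exp_integrable ν hsupp (T - t₂) (by linarith))]
  -- the decreasing part, via the ℝ≥0∞ dilation bound
  have hconv : ∀ τ : ℝ, ∫ E, Real.exp (-(E * τ)) ∂ν = (∫⁻ E, ENNReal.ofReal (Real.exp (-(E * τ))) ∂ν).toReal :=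
    fun τ => integral_eq_lintegral_of_nonneg_ae (Filter.Eventually.of_forall fun E => (Real.exp_pos _).le)
      (by fun_prop : Continuous fun E : ℝ => Real.exp (-(E * τ))).aestronglyMeasurable
  have hd := laplace_dilation_bound ν hsupp A E₀ hA hE₀ (doubling_ennreal ν A E₀ hA hdbl) ht0 htt hwin
  have hK0 : 0 ≤ A * (t₂ / t) ^ 8 * (1 + Real.exp 4) := by positivity
  have htop₂ : (∫⁻ E, ENNReal.ofReal (Real.exp (-(E * t₂))) ∂ν) ≠ ⊤ :=
    ((exp_integrable ν hsupp t₂ ht₂.le).lintegral_lt_top).ne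
  have hdec : ∫ E, Real.exp (-(E * t)) ∂ν ≤ A * (t₂ / t) ^ 8 * (1 + Real.exp 4) * ∫ E, Real.exp (-(E * t₂)) ∂ν := by
    rw [hconv t, hconv t₂, ← ENNReal.toReal_ofReal hK0, ← ENNReal.toReal_mul]
    exact ENNReal.toReal_mono (ENNReal.mul_ne_top ENNReal.ofReal_ne_top htop₂) hd
  -- the increasing part and the constant
  have hinc : ∫ E, Real.exp (-(E * (T - t))) ∂ν ≤ ∫ E, Real.exp (-(E * (T - t₂))) ∂ν := by
    refine integral_mono_ae (exp_integrable ν hsupp (T - t) (by linarith)) (exp_integrable ν hsupp (T - t₂) (by linarith)) ?_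
    filter_upwards [hae] with E hE
    apply Real.exp_le_exp.mpr
    nlinarith
  have hinc0 : 0 ≤ ∫ E, Real.exp (-(E * (T - t))) ∂ν := integral_nonneg fun E => (Real.exp_pos _).le
  have hdec0 : 0 ≤ ∫ E, Real.exp (-(E * t₂)) ∂ν := integral_nonneg fun E => (Real.exp_pos _).le
  have hpow : t ^ 8 ≤ t₂ ^ 8 := pow_le_pow_left₀ ht0.le htt 8
  have ht8 : t ^ 8 * (t₂ / t) ^ 8 = t₂ ^ 8 := by
    rw [← mul_pow]; congr 1; field_simp
  have hK : 1 ≤ A * (1 + Real.exp 4) := by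
    have : (1:ℝ) ≤ 1 + Real.exp 4 := by linarith [Real.exp_pos 4]
    nlinarith
  set ct := ∫ E, Real.exp (-(E * t)) ∂ν with hct
  set ct₂ := ∫ E, Real.exp (-(E * t₂)) ∂ν with hct₂
  set it := ∫ E, Real.exp (-(E * (T - t))) ∂ν with hit
  set it₂ := ∫ E, Real.exp (-(E * (T - t₂))) ∂ν with hit₂
  have h1 : t ^ 8 * κ₀ ≤ A * (1 + Real.exp 4) * t₂ ^ 8 * κ₀ := by
    have : t₂ ^ 8 * κ₀ ≤ A * (1 + Real.exp 4) * (t₂ ^ 8 * κ₀) := le_mul_of_one_le_left (by positivity) hK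
    nlinarith [mul_le_mul_of_nonneg_right hpow hκ₀]
  have h2 : t ^ 8 * ct ≤ A * (1 + Real.exp 4) * t₂ ^ 8 * ct₂ := by
    calc t ^ 8 * ct ≤ t ^ 8 * (A * (t₂ / t) ^ 8 * (1 + Real.exp 4) * ct₂) :=
          mul_le_mul_of_nonneg_left hdec (by positivity)
      _ = A * (1 + Real.exp 4) * (t ^ 8 * (t₂ / t) ^ 8) * ct₂ := by ring
      _ = A * (1 + Real.exp 4) * t₂ ^ 8 * ct₂ := by rw [ht8]
  have h3 : t ^ 8 * it ≤ A * (1 + Real.exp 4) * t₂ ^ 8 * it₂ := by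
    have hit₂0 : 0 ≤ it₂ := le_trans hinc0 hinc
    calc t ^ 8 * it ≤ t ^ 8 * it₂ := mul_le_mul_of_nonneg_left hinc (by positivity)
      _ ≤ t₂ ^ 8 * it₂ := mul_le_mul_of_nonneg_right hpow hit₂0
      _ ≤ A * (1 + Real.exp 4) * (t₂ ^ 8 * it₂) := le_mul_of_one_le_left (by positivity) hK
      _ = A * (1 + Real.exp 4) * t₂ ^ 8 * it₂ := by ring
  have hsum := add_le_add (add_le_add h1 h2) h3
  linarith

end Summit.QuantumFields.YangMills.Cruxes.ScaleMonotonicity.Spectral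

namespace Summit.QuantumFields.YangMills.Theses.AntiScreeningCeilings

/-- the support item `AbelWindowTransfer` (stmt-QuantumFields-27439) by name. -/
theorem abelWindowTransfer_proof : AbelWindowTransfer :=
  fun ν κ₀ A E₀ T hfin hsupp hκ₀ hA hE₀ hdbl t t₂ ht htt hT hwin =>
    Summit.QuantumFields.YangMills.Cruxes.ScaleMonotonicity.Spectral.abelWindowTransfer_core
      ν κ₀ A E₀ T hfin hsupp hκ₀ hA hE₀ hdbl t t₂ ht htt hT hwin

end Summit.QuantumFields.YangMills.Theses.AntiScreeningCeilings
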